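import Summits.AtomisticToContinuum.BoseEinsteinCondensation.Theses.BECRieszReverseHolder
import Literature.MathematicalPhysics.StatisticalMechanics.PeriodicRieszKernelCellMean
import Literature.MathematicalPhysics.QuantumManyBody.PeriodicCondensateCoherence
import Summits.AtomisticToContinuum.BoseEinsteinCondensation.Theorems.BECRieszReverseHolderCoarseRH2Toolkit

/-!
# The shadow's cavity field has zero cell mean (route BECRieszReverseHolder)

The kernel inlined in the crux `RieszShadowFieldMoment` (and in the typed candidate for the informal item
`BoseRieszMembership`, stmt-AtomisticToContinuum-12602) is the Literature's smeared zero-mean periodic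
Riesz kernel at exponent `s = 2`, `Literature.MathematicalPhysics.StatisticalMechanics.periodicRieszKernel 2 L η`
(`K_2 = 2π^{3/2}`, `t^{(1-2)/2} = t^{-1/2}`). Consequently the cavity field
`h_X(y) = Σ_j g(y - X_j)` of any environment `X` has zero mean over the torus cell `[0,L)³`
(periodicity + `∫_{[0,L)³} g = 0`), which is the input of the first Jensen step
`∫_{[0,L)³} e^{-b h_X} ≥ L³` in the glue `RieszShadowFieldMoment → BoseRieszMembership →
CoarseGrainedReverseHolder`.
-/

namespace Summit.AtomisticToContinuum.BoseEinsteinCondensation.Theorems.CoarseRH2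

open MeasureTheory Real
open Literature.MathematicalPhysics.StatisticalMechanics Literature.Analysis.UnboundedOperators
open Literature.MathematicalPhysics.QuantumManyBody BoseGas

/-- The subordination constant at `s = 2` is `K_2 = (4π)^{3/2}·4⁻¹/Γ(1) = 2π^{3/2}`, the prefactor of the
kernel inlined in `RieszShadowFieldMoment`. -/
theorem rieszSubordinationConst_two : rieszSubordinationConst 2 = 2 * π ^ (3 / 2 : ℝ) := by
  rw [rieszSubordinationConst, show ((2 : ℝ) / 2) = 1 by norm_num, Real.Gamma_one, div_one]
  have hπ : 0 < π := Real.pi_pos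
  have h32 : ∀ x : ℝ, 0 ≤ x → x ^ (3 / 2 : ℝ) = x * Real.sqrt x := fun x hx => by
    rw [show (3 / 2 : ℝ) = 1 + 1 / 2 by norm_num]
    rcases hx.eq_or_lt with h0 | hpos
    · rw [← h0, Real.zero_rpow (by norm_num), zero_mul]
    · rw [Real.rpow_add hpos, Real.rpow_one, Real.sqrt_eq_rpow]
  have h4 : (4 : ℝ) ^ (-(1 : ℝ)) = 1 / 4 := by
    rw [Real.rpow_neg_one]; norm_num
  rw [h32 _ (by positivity), h32 _ hπ.le, h4, Real.sqrt_mul' _ hπ.le,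
    show (4 : ℝ) = 2 ^ 2 by norm_num, Real.sqrt_sq (by norm_num)]
  ring

/-- **The inlined kernel of `RieszShadowFieldMoment` is `periodicRieszKernel 2 L η`.** -/
theorem periodicRieszKernel_two_eq (L η : ℝ) :
    periodicRieszKernel 2 L η = fun x => 2 * π ^ (3 / 2 : ℝ) *
      ∫ t in Set.Ioi (η ^ 2), t ^ (-(1 / 2 : ℝ)) *
        ((∑' m : Fin 3 → ℤ, heatKernel t (x - latticeVec L m)) - 1 / L ^ 3) := by
  funext x
  rw [periodicRieszKernel_apply, rieszSubordinationConst_two,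
    show ((1 : ℝ) - 2) / 2 = -(1 / 2 : ℝ) by norm_num]

/-- The periodic Riesz kernel is integrable on the cell (continuous and bounded by `g(0)` on a set of
finite measure; `s > 0`, `L > 0`, `η ≠ 0`). -/
theorem integrableOn_cell_periodicRieszKernel_sub {s L η : ℝ} (hs : 0 < s) (hL : 0 < L) (hη : η ≠ 0)
    (a : Space) : IntegrableOn (fun y => periodicRieszKernel s L η (y - a)) (cell L) volume := by
  have hvol : volume (cell L) < ⊤ := by
    rw [volume_cell]; exact ENNReal.pow_lt_top ENNReal.ofReal_lt_top
  refine Measure.integrableOn_of_bounded (M := periodicRieszKernel s L η 0) hvol.ne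
    (((continuous_periodicRieszKernel s hL hη).comp (continuous_sub_right a)).aestronglyMeasurable)
    (Filter.Eventually.of_forall fun y => ?_)
  rw [Real.norm_eq_abs]
  exact abs_periodicRieszKernel_le hs hL hη _

/-- Cell integrals of the shifted kernel vanish: `∫_{[0,L)³} g(y - a) dy = ∫_{[0,L)³} g = 0`
(coordinate periodicity of `g` and `integral_cell_periodicRieszKernel`). -/
theorem integral_cell_periodicRieszKernel_sub (s : ℝ) {L η : ℝ} (hL : 0 < L) (hη : η ≠ 0)
    (a : Space) : ∫ y in cell L, periodicRieszKernel s L η (y - a) = 0 := by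
  have h := setIntegral_cell_comp_add_of_periodic hL (H := periodicRieszKernel s L η)
    (fun x k => periodicRieszKernel_add_single s L η x k) (-a)
  simp only [← sub_eq_add_neg] at h
  rw [h]
  exact integral_cell_periodicRieszKernel s hL hη

/-- **The cavity field of the shadow gas has zero cell mean**: for every environment
`X = (X_1, …, X_n)` and every coupling `b`, `∫_{[0,L)³} b Σ_j g(y - X_j) dy = 0`
(`g = periodicRieszKernel s L η`, `s > 0`, `L > 0`, `η ≠ 0`). -/
theorem integral_cell_cavityField_eq_zero {s L η : ℝ} (hs : 0 < s) (hL : 0 < L) (hη : η ≠ 0)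
    (b : ℝ) {n : ℕ} (X : Fin n → Space) :
    ∫ y in cell L, b * ∑ j : Fin n, periodicRieszKernel s L η (y - X j) = 0 := by
  rw [integral_const_mul, integral_finsetSum _
    (fun j _ => integrableOn_cell_periodicRieszKernel_sub hs hL hη (X j)),
    Finset.sum_eq_zero (fun j _ => integral_cell_periodicRieszKernel_sub s hL hη (X j)), mul_zero]

/-- The cavity field is continuous (hence measurable) and integrable on the cell. -/
theorem integrableOn_cell_cavityField {s L η : ℝ} (hs : 0 < s) (hL : 0 < L) (hη : η ≠ 0)
    (b : ℝ) {n : ℕ} (X : Fin n → Space) :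
    IntegrableOn (fun y => b * ∑ j : Fin n, periodicRieszKernel s L η (y - X j)) (cell L) volume :=
  (integrable_finsetSum (μ := volume.restrict (cell L)) Finset.univ
    (fun j _ => integrableOn_cell_periodicRieszKernel_sub hs hL hη (X j))).const_mul b

/-- Continuity of the cavity field. -/
theorem continuous_cavityField (s : ℝ) {L η : ℝ} (hL : 0 < L) (hη : η ≠ 0) (b : ℝ) {n : ℕ}
    (X : Fin n → Space) :
    Continuous fun y : Space => b * ∑ j : Fin n, periodicRieszKernel s L η (y - X j) :=
  continuous_const.mul (continuous_finsetSum _ fun j _ =>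
    (continuous_periodicRieszKernel s hL hη).comp (continuous_sub_right (X j)))

/-- **Coarse RH₂ of the tilted shadow slice ≤ its `θ = 2` field moment.** For the shadow weight
`e^{-b h_X}`, `h_X(y) = Σ_j g(y - X_j)` the cavity field of the smeared zero-mean periodic Riesz kernel
`g = periodicRieszKernel s L η` (`s > 0`; `s = 2` is the kernel of `RieszShadowFieldMoment`), every
environment `X`, coupling `b` and resolution `m ≥ 1`:
`m³ Σ_Q (∫_Q e^{-b h_X})² / ∫_{[0,L)³} e^{-b h_X} ≤ ∫_{[0,L)³} e^{-2b h_X}` — the per-slice functional of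
`CoarseGrainedReverseHolder` evaluated on the shadow slice is bounded by the `θ = 2` exponential moment,
deterministically in `X` (Cauchy–Schwarz in cubes + first Jensen with `∫ h_X = 0`). -/
theorem coarseRH2_shadowSlice_le {s L η : ℝ} (hs : 0 < s) (hL : 0 < L) (hη : η ≠ 0) (b : ℝ)
    {m : ℕ} (hm : 0 < m) {n : ℕ} (X : Fin n → Space) :
    (m : ENNReal) ^ 3 * (∑ k : Fin 3 → Fin m, (∫⁻ y in subCell (L / m) k,
        ENNReal.ofReal (Real.exp (-(b * ∑ j : Fin n, periodicRieszKernel s L η (y - X j))))) ^ 2) /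
        (∫⁻ y in cell L, ENNReal.ofReal (Real.exp (-(b * ∑ j : Fin n, periodicRieszKernel s L η (y - X j))))) ≤
      ∫⁻ y in cell L, ENNReal.ofReal
        (Real.exp (-(2 * (b * ∑ j : Fin n, periodicRieszKernel s L η (y - X j))))) :=
  coarseRH2_exp_neg_le_setLIntegral_exp hL hm (continuous_cavityField s hL hη b X).measurable
    (integrableOn_cell_cavityField hs hL hη b X) (integral_cell_cavityField_eq_zero hs hL hη b X)

end Summit.AtomisticToContinuum.BoseEinsteinCondensation.Theorems.CoarseRH2
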